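import Summits.HodgeConjecture.HodgeConjecture.Theorems.Ring2WeilCoverageWeilGramCMPoint
import Summits.HodgeConjecture.HodgeConjecture.Theorems.Ring2WeilCoverageCyclotomicSignaturesG4
import Summits.HodgeConjecture.HodgeConjecture.Theorems.Ring2WeilCoverageRealUnitNormHalfSystems
import Summits.HodgeConjecture.HodgeConjecture.Theorems.Ring2WeilCoverageNormTable
import Mathlib.Tactic.ComputeDegree
import HarnessLib

/-!
# Weil-type family coverage — THE COMPONENTS OF THE WEIL-TYPE `ℤ[ζ₂₄]`-FOURFOLDS, I: `K_d = ℚ(i)` (`i = ζ⁶`): the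
# principal-type form has van Geemen Gram determinant `16 = 4²` in the real frame `1, θ, θ², θ³` of `ℚ(ζ₂₄)⁺ = ℚ(√2, √3)`
# — the SPLIT class, right sign: every principally polarised Weil-type `ℤ[ζ₂₄]`-fourfold for `ℚ(i)` lies on row W4.1.1

research route conditional on HC_CM; not a corollary; Q11.4-sentence-2 already refuted in dim ≥ 3.

Ring 2, WEIL-TYPE FAMILY-COVERAGE CENSUS (`HOME/WEIL-FAMILY-COVERAGE.md` `## b01`, block b01.46 (C2) «with the
`ι`-compatible PRINCIPAL polarisation of the eight YES rows these points sit on the SPLIT rows» — S-pencil there; owner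
ring2-b01), part 89 of the `Ring2WeilCoverage*` series; the level-`24` companion of parts 83–88 (`K = ℚ(ζ₂₄)`, `g = 4`,
`ξ = ζ³/Φ₂₄′(ζ)`, frame `θ^i`, `θ = ζ + ζ⁻¹`).

* §0 level lemmas (`Φ₂₄(ζ) = ζ⁸ − ζ⁴ + 1 = 0`, `θζ = ζ² + 1`, `i = ζ⁶` skew with `i² = −1`) and the evaluation step
  (part 81); §1 the seven traces `Tr(ξ·ζ⁶·θ^m)` and the Gram datum: `b = 0`, **`a = −(0,0,2,0 / 0,2,0,8 / 2,0,8,0 /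
  0,8,0,30)`, `det a = 16`**; §3 `θ^i` is a `ℚ`-basis of `ℚ(ζ₂₄)⁺`.
* §4 **EVERY skew `ζ′` of principal type on `ℤ[ζ₂₄]` gives `16`** (part 82 + THEOREM L (i) at `24`, part 67
  `norm_realUnits_pos_twentyFour`); the `Φ`-positive ones exist on every `ℚ(i)`-balanced `Φ` (census YES row `(24, ℚ(i))`,
  part 75 `exists_principal_twentyFour_sqrt_neg_one`): class **`[16] = [1]` = SPLIT**, `(−1)² det a > 0` — row W4.1.1, the
  census's (F3) for these CM points in the kernel.  Parts 90/91: `K_d = ℚ(√−2), ℚ(√−3), ℚ(√−6)`.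

HONEST FRAMING as parts 82–88; `HC_CM` is used nowhere.  No `def`, no named fact, no `sorry`.  Certificates from
`work/py/gen24.py` (exact arithmetic in `ℚ[x]/Φ₂₄`), re-verified by `linear_combination`.

References: [cite: vanGeemen1994HodgeAV, Lemma 5.2 (2)–(4), 5.4 and (5.4.1)]; [cite: Shimura1998, §14.3 Prop. 4–5,
pp. 103–104]; census b01.46 (C2) (seat-derived).
-/

noncomputable section

open Polynomial NumberField Module
open scoped nonZeroDivisors

namespace Summit.HodgeConjecture.Ring2WeilCoverage.WeilGramLevel24

open Literature.AlgebraicGeometry.VanGeemen1994 (weilField weilNormResidueGroup)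
open Literature.AlgebraicGeometry.Motives (normUnitsSubgroup)
open Literature.NumberTheory.ComplexMultiplication
open Summit.HodgeConjecture.Ring2WeilCoverage.TraceGramDeterminant (trace_aeval_zeta_mul_inv)
open Summit.HodgeConjecture.Ring2WeilCoverage.WeilGramCMPoint
open Summit.HodgeConjecture.Ring2WeilCoverage.RealUnitNormHalfSystems (complexConj_eq_inv)
open Summit.HodgeConjecture.Ring2WeilCoverage.CyclotomicPrincipalObstruction (complexConj_xi)
open Summit.HodgeConjecture.Ring2WeilCoverage.CyclotomicDifferent (isOfType_one_xi_top xi_ne_zero)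
open Summit.HodgeConjecture.Ring2WeilCoverage.RealUnitNormAllLevels (norm_realUnits_pos_twentyFour)
open Summit.HodgeConjecture.HodgeConjecture.Ring2.WeilCoverage (mk_eq_split_of_even mem_normUnitsSubgroup_of_sq_add_mul_sq)
open Summit.HodgeConjecture.HodgeConjecture.Ring2.Hypotheses (splitDiscriminantClass)
variable {K : Type} [Field K] [NumberField K] {ζ : K}

/-! ### §0 Level lemmas -/

/-- `φ(24) = 8`. [folklore] -/
theorem totient_twentyFour : Nat.totient 24 = 8 := by decide

omit [NumberField K] in
/-- **`Φ₂₄(ζ) = 0` written out**: `ζ⁸ − ζ⁴ + 1 = 0` (`(x¹² − 1)(x⁴ + 1)Φ₂₄(x) = x²⁴ − 1`, `ζ¹² ≠ 1`, `ζ⁸ ≠ 1`).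
research route conditional on HC_CM; not a corollary; Q11.4-sentence-2 already refuted in dim ≥ 3. [folklore] -/
theorem cyc_twentyFour (hζ : IsPrimitiveRoot ζ 24) : ζ ^ 8 - ζ ^ 4 + 1 = 0 := by
  have h24 : ζ ^ 24 = 1 := hζ.pow_eq_one
  have h12 : ζ ^ 12 - 1 ≠ 0 := sub_ne_zero.mpr (hζ.pow_ne_one_of_pos_of_lt (by norm_num) (by norm_num))
  have h8 : ζ ^ 8 ≠ 1 := hζ.pow_ne_one_of_pos_of_lt (by norm_num) (by norm_num)
  have h4 : ζ ^ 4 + 1 ≠ 0 := by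
    intro h
    apply h8
    linear_combination (ζ ^ 4 - 1) * h
  have h : (ζ ^ 12 - 1) * (ζ ^ 4 + 1) * (ζ ^ 8 - ζ ^ 4 + 1) = 0 := by
    linear_combination h24
  rcases mul_eq_zero.mp h with h' | h'
  · exact absurd h' (mul_ne_zero h12 h4)
  · exact h'

omit [NumberField K] in
/-- `θζ = ζ² + 1` for `θ = ζ + ζ⁻¹`. [folklore] -/
theorem theta_mul_zeta (hζ : IsPrimitiveRoot ζ 24) : (ζ + ζ⁻¹) * ζ = ζ ^ 2 + 1 := by
  have hζ0 : ζ ≠ 0 := hζ.ne_zero (by norm_num)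
  rw [add_mul, inv_mul_cancel₀ hζ0]
  ring

omit [NumberField K] in
/-- `(ζ⁻¹)^a = ζ^b` when `a + b = 24`. [folklore] -/
theorem inv_pow_eq_pow (hζ : IsPrimitiveRoot ζ 24) {a b : ℕ} (hab : a + b = 24) : ζ⁻¹ ^ a = ζ ^ b := by
  rw [inv_pow]
  apply inv_eq_of_mul_eq_one_right
  rw [← pow_add, hab, hζ.pow_eq_one]

/-- `θ = ζ + ζ⁻¹` is real. [folklore] -/
theorem complexConj_theta [IsCMField K] (hζ : IsPrimitiveRoot ζ 24) :
    IsCMField.complexConj K (ζ + ζ⁻¹) = ζ + ζ⁻¹ := by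
  rw [map_add, map_inv₀, complexConj_eq_inv hζ, inv_inv, add_comm]

/-- The frame `xᵢ = θ^i` is real. [folklore] -/
theorem complexConj_thetaFrame [IsCMField K] (hζ : IsPrimitiveRoot ζ 24) {m : ℕ} {x : Fin m → K}
    (hx : ∀ i, x i = (ζ + ζ⁻¹) ^ (i : ℕ)) (i : Fin m) : IsCMField.complexConj K (x i) = x i := by
  rw [hx i, map_pow, complexConj_theta hζ]

/-- `ξ = ζ³/Φ′(ζ)` is skew (part 7, `g − 1 = 3`). [folklore] -/
theorem complexConj_xi_twentyFour [IsCMField K] (hζ : IsPrimitiveRoot ζ 24) :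
    IsCMField.complexConj K (ζ ^ 3 * (aeval ζ (derivative (cyclotomic 24 ℚ)))⁻¹) =
      -(ζ ^ 3 * (aeval ζ (derivative (cyclotomic 24 ℚ)))⁻¹) :=
  complexConj_xi hζ (k := 3) (by rw [totient_twentyFour])

omit [NumberField K] in
/-- **`(ζ⁶)² = −1`**: `ζ⁶ = i`. [folklore] -/
theorem sq_sqrtNegOne (hζ : IsPrimitiveRoot ζ 24) : (ζ ^ 6) ^ 2 = -1 := by
  linear_combination (1 + ζ ^ 4) * cyc_twentyFour hζ

/-- **`ζ⁶` is skew**: `(ζ⁶)^ρ = ζ¹⁸ = −ζ⁶`. [folklore] -/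
theorem complexConj_sqrtNegOne [IsCMField K] (hζ : IsPrimitiveRoot ζ 24) :
    IsCMField.complexConj K (ζ ^ 6) = -(ζ ^ 6) := by
  rw [map_pow, complexConj_eq_inv hζ, inv_pow_eq_pow hζ (show 6 + 18 = 24 by norm_num)]
  linear_combination (ζ ^ 6 + ζ ^ 10) * cyc_twentyFour hζ

/-! ### §0b The evaluation step: `Tr(y·θ^m)` from a certificate `y(ζ² + 1)^m = R(ζ)Φ′(ζ)⁻¹ζ^m` (part 81) -/

/-- Evaluation of an explicit polynomial of degree `≤ 7` at `ζ`. [folklore] -/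
theorem aeval_poly₈ (ζ : K) (c₀ c₁ c₂ c₃ c₄ c₅ c₆ c₇ : ℚ) :
    aeval ζ (C c₀ + C c₁ * X + C c₂ * X ^ 2 + C c₃ * X ^ 3 + C c₄ * X ^ 4 + C c₅ * X ^ 5 + C c₆ * X ^ 6 + C c₇ * X ^ 7) =
      (c₀ : K) + (c₁ : K) * ζ + (c₂ : K) * ζ ^ 2 + (c₃ : K) * ζ ^ 3 + (c₄ : K) * ζ ^ 4 + (c₅ : K) * ζ ^ 5 +
        (c₆ : K) * ζ ^ 6 + (c₇ : K) * ζ ^ 7 := by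
  simp only [map_add, map_mul, map_pow, aeval_C, aeval_X, eq_ratCast]

/-- `Tr_{K/ℚ}(y) = coeff₇(R)` if `y = R(ζ)/Φ′(ζ)` with `deg R ≤ 7` (part 81 `trace_aeval_zeta_mul_inv`). research route conditional on HC_CM; not a corollary; Q11.4-sentence-2 already refuted in dim ≥ 3. [folklore] -/
theorem trace_of_key₀ [IsCyclotomicExtension {24} ℚ K] (hζ : IsPrimitiveRoot ζ 24) {y : K} (R : ℚ[X])
    (hR : R.natDegree ≤ 7) (hkey : y = aeval ζ R * (aeval ζ (derivative (cyclotomic 24 ℚ)))⁻¹) :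
    Algebra.trace ℚ K y = R.coeff 7 := by
  rw [hkey, trace_aeval_zeta_mul_inv hζ R (by rw [totient_twentyFour]; omega), totient_twentyFour]

/-- `Tr_{K/ℚ}(y·θ) = coeff₇(R)` if `y(ζ² + 1) = R(ζ)Φ′(ζ)⁻¹·ζ` (`θζ = ζ² + 1`). research route conditional on HC_CM; not a corollary; Q11.4-sentence-2 already refuted in dim ≥ 3. [folklore] -/
theorem trace_of_key₁ [IsCyclotomicExtension {24} ℚ K] (hζ : IsPrimitiveRoot ζ 24) {y : K} (R : ℚ[X])
    (hR : R.natDegree ≤ 7) (hkey : y * (ζ ^ 2 + 1) = aeval ζ R * (aeval ζ (derivative (cyclotomic 24 ℚ)))⁻¹ * ζ) :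
    Algebra.trace ℚ K (y * (ζ + ζ⁻¹)) = R.coeff 7 := by
  have hζ0 : ζ ≠ 0 := hζ.ne_zero (by norm_num)
  refine trace_of_key₀ hζ R hR (mul_right_cancel₀ hζ0 ?_)
  rw [mul_assoc, theta_mul_zeta hζ, hkey]

/-- `Tr_{K/ℚ}(y·θ^m) = coeff₇(R)` if `y(ζ² + 1)^m = R(ζ)Φ′(ζ)⁻¹·ζ^m` (`θ^m ζ^m = (ζ² + 1)^m`). research route conditional on HC_CM; not a corollary; Q11.4-sentence-2 already refuted in dim ≥ 3. [folklore] -/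
theorem trace_of_key [IsCyclotomicExtension {24} ℚ K] (hζ : IsPrimitiveRoot ζ 24) {y : K} {m : ℕ} (R : ℚ[X])
    (hR : R.natDegree ≤ 7) (hkey : y * (ζ ^ 2 + 1) ^ m = aeval ζ R * (aeval ζ (derivative (cyclotomic 24 ℚ)))⁻¹ * ζ ^ m) :
    Algebra.trace ℚ K (y * (ζ + ζ⁻¹) ^ m) = R.coeff 7 := by
  have hζ0 : ζ ≠ 0 := hζ.ne_zero (by norm_num)
  refine trace_of_key₀ hζ R hR (mul_right_cancel₀ (pow_ne_zero m hζ0) ?_)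
  rw [mul_assoc, ← mul_pow, theta_mul_zeta hζ, hkey]

/-! ### §1 The principal-type form `E_ξ` for `K_d = ℚ(i)`: seven traces, the Hankel matrix, `det = 16` -/

/-- `Tr(ζ′sθ^0) = 0` for `ζ′ = ξ = ζ³/Φ′(ζ)`, `s = √−1 = ζ⁶`, `θ = ζ + ζ⁻¹` (Euler evaluation). research route conditional on HC_CM; not a corollary; Q11.4-sentence-2 already refuted in dim ≥ 3. [folklore] -/
theorem trace_xi_sqrtNegOne_zero [IsCyclotomicExtension {24} ℚ K] (hζ : IsPrimitiveRoot ζ 24) :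
    Algebra.trace ℚ K ((ζ ^ 3 * (aeval ζ (derivative (cyclotomic 24 ℚ)))⁻¹) * ζ ^ 6) = 0 := by
  have hΦ := cyc_twentyFour hζ
  rw [trace_of_key₀ hζ (C (0 : ℚ) + C (-1 : ℚ) * X + C (0 : ℚ) * X ^ 2 + C (0 : ℚ) * X ^ 3 + C (0 : ℚ) * X ^ 4 + C (1 : ℚ) * X ^ 5 +
      C (0 : ℚ) * X ^ 6 + C (0 : ℚ) * X ^ 7) (by compute_degree) (by
    rw [aeval_poly₈]
    push_cast
    linear_combination ((aeval ζ (derivative (cyclotomic 24 ℚ)))⁻¹ * (ζ)) * hΦ)]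
  norm_num [coeff_X_pow, coeff_X, coeff_C, coeff_one]

/-- `Tr(ζ′sθ^1) = 0` for `ζ′ = ξ = ζ³/Φ′(ζ)`, `s = √−1 = ζ⁶`, `θ = ζ + ζ⁻¹` (Euler evaluation). research route conditional on HC_CM; not a corollary; Q11.4-sentence-2 already refuted in dim ≥ 3. [folklore] -/
theorem trace_xi_sqrtNegOne_one [IsCyclotomicExtension {24} ℚ K] (hζ : IsPrimitiveRoot ζ 24) :
    Algebra.trace ℚ K ((ζ ^ 3 * (aeval ζ (derivative (cyclotomic 24 ℚ)))⁻¹) * ζ ^ 6 * (ζ + ζ⁻¹)) = 0 := by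
  have hΦ := cyc_twentyFour hζ
  rw [trace_of_key₁ hζ (C (-1 : ℚ) + C (0 : ℚ) * X + C (-1 : ℚ) * X ^ 2 + C (0 : ℚ) * X ^ 3 + C (1 : ℚ) * X ^ 4 +
      C (0 : ℚ) * X ^ 5 + C (1 : ℚ) * X ^ 6 + C (0 : ℚ) * X ^ 7) (by compute_degree) (by
    rw [aeval_poly₈]
    push_cast
    linear_combination ((aeval ζ (derivative (cyclotomic 24 ℚ)))⁻¹ * (ζ + ζ^3)) * hΦ)]
  norm_num [coeff_X_pow, coeff_X, coeff_C, coeff_one]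

/-- `Tr(ζ′sθ^2) = 2` for `ζ′ = ξ = ζ³/Φ′(ζ)`, `s = √−1 = ζ⁶`, `θ = ζ + ζ⁻¹` (Euler evaluation). research route conditional on HC_CM; not a corollary; Q11.4-sentence-2 already refuted in dim ≥ 3. [folklore] -/
theorem trace_xi_sqrtNegOne_two [IsCyclotomicExtension {24} ℚ K] (hζ : IsPrimitiveRoot ζ 24) :
    Algebra.trace ℚ K ((ζ ^ 3 * (aeval ζ (derivative (cyclotomic 24 ℚ)))⁻¹) * ζ ^ 6 * (ζ + ζ⁻¹) ^ 2) = 2 := by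
  have hΦ := cyc_twentyFour hζ
  rw [trace_of_key hζ (C (0 : ℚ) + C (-2 : ℚ) * X + C (0 : ℚ) * X ^ 2 + C (-1 : ℚ) * X ^ 3 + C (0 : ℚ) * X ^ 4 +
      C (2 : ℚ) * X ^ 5 + C (0 : ℚ) * X ^ 6 + C (2 : ℚ) * X ^ 7) (by compute_degree) (by
    rw [aeval_poly₈]
    push_cast
    linear_combination ((aeval ζ (derivative (cyclotomic 24 ℚ)))⁻¹ * (2 * ζ^3 + ζ^5)) * hΦ)]
  norm_num [coeff_X_pow, coeff_X, coeff_C, coeff_one]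

/-- `Tr(ζ′sθ^3) = 0` for `ζ′ = ξ = ζ³/Φ′(ζ)`, `s = √−1 = ζ⁶`, `θ = ζ + ζ⁻¹` (Euler evaluation). research route conditional on HC_CM; not a corollary; Q11.4-sentence-2 already refuted in dim ≥ 3. [folklore] -/
theorem trace_xi_sqrtNegOne_three [IsCyclotomicExtension {24} ℚ K] (hζ : IsPrimitiveRoot ζ 24) :
    Algebra.trace ℚ K ((ζ ^ 3 * (aeval ζ (derivative (cyclotomic 24 ℚ)))⁻¹) * ζ ^ 6 * (ζ + ζ⁻¹) ^ 3) = 0 := by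
  have hΦ := cyc_twentyFour hζ
  rw [trace_of_key hζ (C (-4 : ℚ) + C (0 : ℚ) * X + C (-3 : ℚ) * X ^ 2 + C (0 : ℚ) * X ^ 3 + C (3 : ℚ) * X ^ 4 +
      C (0 : ℚ) * X ^ 5 + C (4 : ℚ) * X ^ 6 + C (0 : ℚ) * X ^ 7) (by compute_degree) (by
    rw [aeval_poly₈]
    push_cast
    linear_combination ((aeval ζ (derivative (cyclotomic 24 ℚ)))⁻¹ * (4 * ζ^3 + 3 * ζ^5 + ζ^7)) * hΦ)]
  norm_num [coeff_X_pow, coeff_X, coeff_C, coeff_one]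

/-- `Tr(ζ′sθ^4) = 8` for `ζ′ = ξ = ζ³/Φ′(ζ)`, `s = √−1 = ζ⁶`, `θ = ζ + ζ⁻¹` (Euler evaluation). research route conditional on HC_CM; not a corollary; Q11.4-sentence-2 already refuted in dim ≥ 3. [folklore] -/
theorem trace_xi_sqrtNegOne_four [IsCyclotomicExtension {24} ℚ K] (hζ : IsPrimitiveRoot ζ 24) :
    Algebra.trace ℚ K ((ζ ^ 3 * (aeval ζ (derivative (cyclotomic 24 ℚ)))⁻¹) * ζ ^ 6 * (ζ + ζ⁻¹) ^ 4) = 8 := by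
  have hΦ := cyc_twentyFour hζ
  rw [trace_of_key hζ (C (0 : ℚ) + C (-7 : ℚ) * X + C (0 : ℚ) * X ^ 2 + C (-4 : ℚ) * X ^ 3 + C (0 : ℚ) * X ^ 4 +
      C (7 : ℚ) * X ^ 5 + C (0 : ℚ) * X ^ 6 + C (8 : ℚ) * X ^ 7) (by compute_degree) (by
    rw [aeval_poly₈]
    push_cast
    linear_combination ((aeval ζ (derivative (cyclotomic 24 ℚ)))⁻¹ * (7 * ζ^5 + 4 * ζ^7 + ζ^9)) * hΦ)]
  norm_num [coeff_X_pow, coeff_X, coeff_C, coeff_one]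

/-- `Tr(ζ′sθ^5) = 0` for `ζ′ = ξ = ζ³/Φ′(ζ)`, `s = √−1 = ζ⁶`, `θ = ζ + ζ⁻¹` (Euler evaluation). research route conditional on HC_CM; not a corollary; Q11.4-sentence-2 already refuted in dim ≥ 3. [folklore] -/
theorem trace_xi_sqrtNegOne_five [IsCyclotomicExtension {24} ℚ K] (hζ : IsPrimitiveRoot ζ 24) :
    Algebra.trace ℚ K ((ζ ^ 3 * (aeval ζ (derivative (cyclotomic 24 ℚ)))⁻¹) * ζ ^ 6 * (ζ + ζ⁻¹) ^ 5) = 0 := by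
  have hΦ := cyc_twentyFour hζ
  rw [trace_of_key hζ (C (-15 : ℚ) + C (0 : ℚ) * X + C (-11 : ℚ) * X ^ 2 + C (0 : ℚ) * X ^ 3 + C (11 : ℚ) * X ^ 4 +
      C (0 : ℚ) * X ^ 5 + C (15 : ℚ) * X ^ 6 + C (0 : ℚ) * X ^ 7) (by compute_degree) (by
    rw [aeval_poly₈]
    push_cast
    linear_combination ((aeval ζ (derivative (cyclotomic 24 ℚ)))⁻¹ * (15 * ζ^5 + 11 * ζ^7 + 5 * ζ^9 + ζ^11)) * hΦ)]
  norm_num [coeff_X_pow, coeff_X, coeff_C, coeff_one]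

/-- `Tr(ζ′sθ^6) = 30` for `ζ′ = ξ = ζ³/Φ′(ζ)`, `s = √−1 = ζ⁶`, `θ = ζ + ζ⁻¹` (Euler evaluation). research route conditional on HC_CM; not a corollary; Q11.4-sentence-2 already refuted in dim ≥ 3. [folklore] -/
theorem trace_xi_sqrtNegOne_six [IsCyclotomicExtension {24} ℚ K] (hζ : IsPrimitiveRoot ζ 24) :
    Algebra.trace ℚ K ((ζ ^ 3 * (aeval ζ (derivative (cyclotomic 24 ℚ)))⁻¹) * ζ ^ 6 * (ζ + ζ⁻¹) ^ 6) = 30 := by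
  have hΦ := cyc_twentyFour hζ
  rw [trace_of_key hζ (C (0 : ℚ) + C (-26 : ℚ) * X + C (0 : ℚ) * X ^ 2 + C (-15 : ℚ) * X ^ 3 + C (0 : ℚ) * X ^ 4 +
      C (26 : ℚ) * X ^ 5 + C (0 : ℚ) * X ^ 6 + C (30 : ℚ) * X ^ 7) (by compute_degree) (by
    rw [aeval_poly₈]
    push_cast
    linear_combination ((aeval ζ (derivative (cyclotomic 24 ℚ)))⁻¹ * (26 * ζ^7 + 16 * ζ^9 + 6 * ζ^11 + ζ^13)) * hΦ)]
  norm_num [coeff_X_pow, coeff_X, coeff_C, coeff_one]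

/-- **The Gram datum `a` of `(E_ζ′, s)` in the real frame `θ^i` (`i < 4`)** for `ζ′ = ξ = ζ³/Φ′(ζ)` (principal type (1)),
`s = √−1 = ζ⁶`: the integer Hankel matrix `(−Tr(ζ′sθ^{i+j}))ᵢⱼ` (and `b = 0`, part 82 `hb_eq_zero`).
research route conditional on HC_CM; not a corollary; Q11.4-sentence-2 already refuted in dim ≥ 3. [cite: vanGeemen1994HodgeAV, Lemma 5.2 (2)–(3)] -/
theorem realPart_xi_sqrtNegOne [IsCyclotomicExtension {24} ℚ K] [IsCMField K] (hζ : IsPrimitiveRoot ζ 24)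
    {x : Fin 4 → K} (hx : ∀ i, x i = (ζ + ζ⁻¹) ^ (i : ℕ)) {a : Matrix (Fin 4) (Fin 4) ℚ}
    (ha : ∀ i j, a i j = Algebra.trace ℚ K ((ζ ^ 3 * (aeval ζ (derivative (cyclotomic 24 ℚ)))⁻¹) * x i * IsCMField.complexConj K (ζ ^ 6 * x j))) :
    a = !![0, 0, -2, 0; 0, -2, 0, -8; -2, 0, -8, 0; 0, -8, 0, -30] := by
  rw [ha_eq (complexConj_sqrtNegOne hζ) (complexConj_thetaFrame hζ hx) ha]
  ext i j
  simp only [Matrix.of_apply, hx, ← pow_add]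
  fin_cases i <;> fin_cases j <;> simp [trace_xi_sqrtNegOne_zero hζ, trace_xi_sqrtNegOne_one hζ, trace_xi_sqrtNegOne_two hζ, trace_xi_sqrtNegOne_three hζ, trace_xi_sqrtNegOne_four hζ, trace_xi_sqrtNegOne_five hζ, trace_xi_sqrtNegOne_six hζ]

/-- **`det a = 16`** for `ζ′ = ξ = ζ³/Φ′(ζ)`, `s = √−1 = ζ⁶` (frame `θ^i`). research route conditional on HC_CM; not a corollary; Q11.4-sentence-2 already refuted in dim ≥ 3. [cite: vanGeemen1994HodgeAV, Lemma 5.2 (3)] -/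
theorem det_realPart_xi_sqrtNegOne [IsCyclotomicExtension {24} ℚ K] [IsCMField K] (hζ : IsPrimitiveRoot ζ 24)
    {x : Fin 4 → K} (hx : ∀ i, x i = (ζ + ζ⁻¹) ^ (i : ℕ)) {a : Matrix (Fin 4) (Fin 4) ℚ}
    (ha : ∀ i j, a i j = Algebra.trace ℚ K ((ζ ^ 3 * (aeval ζ (derivative (cyclotomic 24 ℚ)))⁻¹) * x i * IsCMField.complexConj K (ζ ^ 6 * x j))) :
    a.det = 16 := by
  rw [realPart_xi_sqrtNegOne hζ hx ha]
  simp [Matrix.det_succ_row_zero, Fin.sum_univ_succ, Fin.succAbove, Matrix.submatrix]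
  norm_num

/-! ### §3 `1, θ, θ², θ³` is a `ℚ`-basis of `K⁺ = ℚ(ζ_24)⁺` -/

/-- `[ℚ(ζ_24)⁺ : ℚ] = 4`. [folklore] -/
theorem finrank_realSubfield [IsCyclotomicExtension {24} ℚ K] [IsCMField K] :
    finrank ℚ (maximalRealSubfield K) = 4 := by
  have h1 : finrank ℚ K = 8 := by
    rw [IsCyclotomicExtension.finrank K (cyclotomic.irreducible_rat (by norm_num : 0 < 24))]; decide
  have h2 := Module.finrank_mul_finrank ℚ (maximalRealSubfield K) K
  rw [Algebra.IsQuadraticExtension.finrank_eq_two (maximalRealSubfield K) K, h1] at h2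
  omega

/-- **`1, θ, θ², θ³` are `ℚ`-linearly independent in `K⁺`**: a relation `Σ cₖ θ^k = 0`, multiplied by `ξ s θ^m` and
traced, gives the Hankel system of §1 (`m ≤ 3`), whose determinant is non-zero.
research route conditional on HC_CM; not a corollary; Q11.4-sentence-2 already refuted in dim ≥ 3. [folklore] -/
theorem linearIndependent_thetaPow [IsCyclotomicExtension {24} ℚ K] [IsCMField K] (hζ : IsPrimitiveRoot ζ 24)
    {ω : Fin 4 → maximalRealSubfield K} (hω : ∀ i, (ω i : K) = (ζ + ζ⁻¹) ^ (i : ℕ)) : LinearIndependent ℚ ω := by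
  rw [Fintype.linearIndependent_iff]
  intro c hc
  have hcK : ∑ i : Fin 4, (c i : K) * (ζ + ζ⁻¹) ^ (i : ℕ) = 0 := by
    have h := congrArg (fun y : maximalRealSubfield K => (y : K)) hc
    simp only [ZeroMemClass.coe_zero] at h
    rw [← h]
    push_cast
    refine Finset.sum_congr rfl fun i _ => ?_
    rw [Rat.smul_def, hω i]
  have E : ∀ m : ℕ, ∑ i : Fin 4, c i * Algebra.trace ℚ K ((ζ ^ 3 * (aeval ζ (derivative (cyclotomic 24 ℚ)))⁻¹) * ζ ^ 6 *
      (ζ + ζ⁻¹) ^ (m + (i : ℕ))) = 0 := by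
    intro m
    have h := congrArg (fun y => Algebra.trace ℚ K ((ζ ^ 3 * (aeval ζ (derivative (cyclotomic 24 ℚ)))⁻¹) * ζ ^ 6 * (ζ + ζ⁻¹) ^ m * y)) hcK
    simp only [mul_zero, map_zero, Finset.mul_sum, map_sum] at h
    rw [← h]
    refine Finset.sum_congr rfl fun i _ => ?_
    rw [show (ζ ^ 3 * (aeval ζ (derivative (cyclotomic 24 ℚ)))⁻¹) * ζ ^ 6 * (ζ + ζ⁻¹) ^ m *
        ((c i : K) * (ζ + ζ⁻¹) ^ (i : ℕ)) = (c i) • ((ζ ^ 3 * (aeval ζ (derivative (cyclotomic 24 ℚ)))⁻¹) * ζ ^ 6 *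
        (ζ + ζ⁻¹) ^ (m + (i : ℕ))) by rw [Rat.smul_def, pow_add]; ring, map_smul, smul_eq_mul]
  have e0 := E 0
  have e1 := E 1
  have e2 := E 2
  have e3 := E 3
  simp only [Fin.sum_univ_four, Fin.isValue, Fin.val_zero, Fin.val_one, Fin.val_two, show ((3 : Fin 4) : ℕ) = 3 from rfl,
    Nat.reduceAdd, zero_add, add_zero, pow_zero, mul_one, pow_one, trace_xi_sqrtNegOne_zero hζ, trace_xi_sqrtNegOne_one hζ, trace_xi_sqrtNegOne_two hζ, trace_xi_sqrtNegOne_three hζ, trace_xi_sqrtNegOne_four hζ, trace_xi_sqrtNegOne_five hζ, trace_xi_sqrtNegOne_six hζ] at e0 e1 e2 e3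
  have c0 : c 0 = 0 := by linear_combination (-2 : ℚ) * e0 + ((1 : ℚ) / 2) * e2
  have c1 : c 1 = 0 := by linear_combination ((-15 : ℚ) / 2) * e1 + (2 : ℚ) * e3
  have c2 : c 2 = 0 := by linear_combination ((1 : ℚ) / 2) * e0
  have c3 : c 3 = 0 := by linear_combination (2 : ℚ) * e1 + ((-1 : ℚ) / 2) * e3
  intro i
  fin_cases i
  · exact c0
  · exact c1
  · exact c2
  · exact c3

/-- **A `ℚ`-basis `ωb` of `K⁺ = ℚ(ζ_24)⁺ with `ωb i = θ^i`** (`i < 4`). [folklore] -/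
theorem exists_basis_thetaPow [IsCyclotomicExtension {24} ℚ K] [IsCMField K] (hζ : IsPrimitiveRoot ζ 24) :
    ∃ ωb : Basis (Fin 4) ℚ (maximalRealSubfield K), ∀ i, (ωb i : K) = (ζ + ζ⁻¹) ^ (i : ℕ) := by
  let θ' : maximalRealSubfield K :=
    ⟨ζ + ζ⁻¹, (IsCMField.complexConj_eq_self_iff K (ζ + ζ⁻¹)).mp (complexConj_theta hζ)⟩
  let ω : Fin 4 → maximalRealSubfield K := fun i => θ' ^ (i : ℕ)
  have hω : ∀ i, (ω i : K) = (ζ + ζ⁻¹) ^ (i : ℕ) := fun i => by simp [ω, θ']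
  have hli := linearIndependent_thetaPow hζ hω
  have hcard : Fintype.card (Fin 4) = finrank ℚ (maximalRealSubfield K) := by
    rw [Fintype.card_fin, finrank_realSubfield]
  exact ⟨basisOfLinearIndependentOfCardEqFinrank hli hcard, fun i => by
    rw [coe_basisOfLinearIndependentOfCardEqFinrank]; exact hω i⟩

/-! ### §4 Every principal-type parameter gives `16` (THEOREM L (i) at `24`); the class is SPLIT -/

/-- **For EVERY skew `ζ′` of PRINCIPAL type on `ℤ[ζ_24]` (`IsOfType 1 ζ′ ⊤`; `ζ′ = uξ`, `u` a real unit, `N(u) = 1`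
by THEOREM L (i) at `24`) the Gram determinant of `(E_ζ′, ζ⁶)` in the frame `θ^i` is `16`** — for every `Φ` and
every `Φ`-positive such `ζ′` (they exist on every `ζ⁶`-balanced `Φ`: the census YES row, part 75
`exists_principal_twentyFour_…`): the SPLIT row W4.1.1 `= (2, ℚ(i), 1)`; `(−1)² det a > 0`, the right sign for Weil signature `(2,2)` [vG94 5.2 (4)].
research route conditional on HC_CM; not a corollary; Q11.4-sentence-2 already refuted in dim ≥ 3. [cite: vanGeemen1994HodgeAV, Lemma 5.2 (3)–(4) and (5.4.1)] [cite: Shimura1998, §14.3 Prop. 5, p. 104] -/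
theorem det_realPart_principal_sqrtNegOne [IsCyclotomicExtension {24} ℚ K] [IsCMField K]
    (hζ : IsPrimitiveRoot ζ 24) {ζ' : K} (hζ' : IsCMField.complexConj K ζ' = -ζ')
    (hT : CMTypeLattice.IsOfType (1 : (FractionalIdeal (𝓞 K)⁰ K)ˣ) ζ' ⊤)
    {x : Fin 4 → K} (hx : ∀ i, x i = (ζ + ζ⁻¹) ^ (i : ℕ)) {a : Matrix (Fin 4) (Fin 4) ℚ}
    (ha : ∀ i j, a i j = Algebra.trace ℚ K (ζ' * x i * IsCMField.complexConj K (ζ ^ 6 * x j))) :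
    a.det = 16 := by
  obtain ⟨ωb, hωb⟩ := exists_basis_thetaPow hζ
  have hx' : ∀ i, x i = (ωb i : K) := fun i => (hx i).trans (hωb i).symm
  rw [det_realPart_eq_of_isOfType ωb (complexConj_sqrtNegOne hζ) hx' (norm_realUnits_pos_twentyFour hζ)
    (complexConj_xi_twentyFour hζ) (xi_ne_zero hζ 3) hζ' (isOfType_one_xi_top hζ 3) hT (fun i j => rfl) ha]
  exact det_realPart_xi_sqrtNegOne hζ hx (fun i j => rfl)

/-- **`[16] = [1]`, the SPLIT class, in `ℚˣ/Nm(ℚ(√−1)ˣ)`** (`16 = 4² + 1·0²`): the principally polarised Weil-type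
`ℤ[ζ_24]`-fourfolds for `ℚ(√−1)` lie on the SPLIT component — the SPLIT row W4.1.1 `= (2, ℚ(i), 1)` (the census's (F3) «`𝒪_K`-linear + principal ⟹
split» for these CM points, as a kernel theorem).
research route conditional on HC_CM; not a corollary; Q11.4-sentence-2 already refuted in dim ≥ 3. [cite: vanGeemen1994HodgeAV, 5.4 and (5.4.1)] -/
theorem mk0_det_principal_sqrtNegOne :
    (QuotientGroup.mk (Units.mk0 (16 : ℚ) (by norm_num)) : weilNormResidueGroup 1) = splitDiscriminantClass 2 1 :=
  mk_eq_split_of_even (by decide) _ (mem_normUnitsSubgroup_of_sq_add_mul_sq _ (4 : ℚ) (0 : ℚ) (by norm_num))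

end Summit.HodgeConjecture.Ring2WeilCoverage.WeilGramLevel24

end
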